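import Mathlib
import HarnessLib
import Literature.Analysis.FluidPDE.SteadyStrainedNS
import Literature.Analysis.FluidPDE.SteadyNSLocalEnergy

/-!
# Stub `stub_solitonEnergyFlux` — the soliton energy–flux identity

Crux `PointSink.ConeDesingularisation` (stmt-AnomalousDissipation-19034), line `Sketch`, TOOLS stub.

Let `(Q, Pr)` be a smooth steady unforced unit-viscosity Navier–Stokes solution on `ℝ³`
(`IsSteadyClassicalNS 1 0 Q Pr`) with finite Dirichlet integral `D = ∫ |∇Q|²` and the `L²`-mass
envelope `∫_{B_R} |Q|² ≤ C R^{5/3}` (`R ≥ 1`).  For a test function `φ ∈ C²_c(ℝ³)` and its discretely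
self-similar rescalings `φ_k(x) = φ((λ^k)⁻¹ x)`, `λ > 1`, the tested energy flux converges to the
dissipation: `∫ (Dφ_k·Q)(½|Q|² + Pr) → φ(0) D`.

Proof.  The tree's localised energy identity
`IsLerayProfile.integral_mul_frobeniusNormSq_eq` (Galdi 2011, proof of Thm X.9.5; Seregin–Wang 2020,
proof of Prop. 2.1: test the momentum equation against `φ_k Q`) gives
`∫ (Dφ_k·Q)(½|Q|² + Pr) = ∫ φ_k |∇Q|² − ½ ∫ (Δφ_k)|Q|²`
(`solitonFlux_identity`; the bridge `IsSteadyClassicalNS 1 0 → IsLerayProfile 1 0` is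
`solitonFlux_isLerayProfile`, the chain rules `Dφ_k(x) = (λ^k)⁻¹ Dφ((λ^k)⁻¹x)`,
`Δφ_k(x) = (λ^k)⁻² (Δφ)((λ^k)⁻¹x)` are Mathlib's `fderiv_comp_smul` and
`solitonFlux_laplacian_comp_smul`).  Then `∫ φ_k |∇Q|² → φ(0) D` by dominated convergence
(`solitonFlux_tendsto_dissipation`), and, with `supp φ ⊆ B_ρ`, `|Δφ| ≤ S`,
`|∫ (Δφ_k)|Q|²| ≤ (λ^k)⁻² S ∫_{B_{ρλ^k}} |Q|² ≤ S C ρ^{5/3} (λ^k)^{-1/3} → 0`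
(`solitonFlux_laplacian_term_le`).
-/

noncomputable section

-- `Summit.<Summit>.<Problem>`: single-conjunct summit, the duplicate namespace is mandated (CONVENTIONS §2).
set_option linter.dupNamespace false

namespace Summit.AnomalousDissipation.AnomalousDissipation.Theorems

open MeasureTheory Filter Topology Set
open Literature.Analysis.FluidPDE
open scoped Laplacian

/-- Points / velocity values of `ℝ³`. -/
local notation "E³" => EuclideanSpace ℝ (Fin 3)

/-- **Bridge.** A smooth steady unforced unit-viscosity Navier–Stokes solution is a Leray profile
at rate `0`, viscosity `1` (`−ΔQ + (Q·∇)Q + ∇Pr = 0`, `div Q = 0`, `Q ∈ C²`, `Pr ∈ C¹`). -/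
theorem solitonFlux_isLerayProfile {Q : E³ → E³} {Pr : E³ → ℝ} (h : IsSteadyClassicalNS 1 0 Q Pr) :
    IsLerayProfile 1 0 Q Pr where
  contDiff_velocity := contDiff_infty.1 h.smooth_velocity 2
  contDiff_pressure := contDiff_infty.1 h.smooth_pressure 1
  profile_eq y := by
    have hm := h.momentum y
    simp only [one_smul, Pi.zero_apply, add_zero] at hm
    simp only [one_smul, zero_smul, add_zero, hm]
    abel
  divFree := h.divFree

/-- **Derivative under a homothety**: `D(k • f(c ·))(x) = (k c) • Df(c x)` for all `k c : ℝ`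
(no differentiability needed: both sides are the junk value `0` together). -/
theorem solitonFlux_fderiv_const_smul_comp_smul {F : Type*} [NormedAddCommGroup F]
    [NormedSpace ℝ F] (f : E³ → F) (k c : ℝ) (x : E³) :
    fderiv ℝ (fun y => k • f (c • y)) x = (k * c) • fderiv ℝ f (c • x) := by
  -- adapted from `fderiv_const_smul_comp_smul_apply` of
  -- `Literature/Analysis/FluidPDE/FlatSwirlGauge.lean`
  have h : (fun y => k • f (c • y)) = k • fun y => f (c • y) := rfl
  rw [h, fderiv_const_smul_field, Pi.smul_apply, fderiv_comp_smul, smul_smul]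

/-- **Laplacian under a homothety**: `Δ(f(c ·))(x) = c² (Δf)(c x)` (no differentiability needed). -/
theorem solitonFlux_laplacian_comp_smul (f : E³ → ℝ) (c : ℝ) (x : E³) :
    (Δ (fun w => f (c • w))) x = c ^ 2 * (Δ f) (c • x) := by
  -- adapted from `laplacian_comp_smul_eq` of `Literature/Analysis/FluidPDE/FlatSwirlGauge.lean`
  have h1 : (fderiv ℝ fun w => f (c • w)) = fun z => c • fderiv ℝ f (c • z) := by
    funext z
    simpa using solitonFlux_fderiv_const_smul_comp_smul f 1 c z
  have h2 : fderiv ℝ (fderiv ℝ fun w => f (c • w)) =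
      fun z => c ^ 2 • fderiv ℝ (fderiv ℝ f) (c • z) := by
    rw [h1]
    funext z
    rw [solitonFlux_fderiv_const_smul_comp_smul (fderiv ℝ f) c c z, sq]
  rw [InnerProductSpace.laplacian_eq_iteratedFDeriv_orthonormalBasis (fun w => f (c • w))
      (stdOrthonormalBasis ℝ E³),
    InnerProductSpace.laplacian_eq_iteratedFDeriv_orthonormalBasis f (stdOrthonormalBasis ℝ E³)]
  simp only [iteratedFDeriv_two_apply, Finset.mul_sum, h2]
  simp

/-- `c² · (c⁻¹)^{5/3} = c^{1/3}` for `c > 0`. -/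
theorem solitonFlux_rpow_aux {c : ℝ} (hc : 0 < c) :
    c ^ 2 * c⁻¹ ^ (5 / 3 : ℝ) = c ^ (1 / 3 : ℝ) := by
  rw [Real.inv_rpow hc.le, ← Real.rpow_neg hc.le, ← Real.rpow_two, ← Real.rpow_add hc]
  norm_num

/-- **The localised energy identity at one scale.** For a Leray profile `(Q, Pr)` at rate `0`,
viscosity `1`, a test function `φ ∈ C²_c` and `c ≠ 0`, with `φ_c = φ(c ·)`
(`Dφ_c(x) v = c Dφ(cx) v`, `Δφ_c(x) = c² (Δφ)(cx)`):
`∫ (c Dφ(cx)·Q(x)) (|Q|²/2 + Pr) = ∫ φ(cx) |∇Q|² − ½ ∫ c² (Δφ)(cx) |Q|²`. -/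
theorem solitonFlux_identity {Q : E³ → E³} {Pr : E³ → ℝ} (h : IsLerayProfile 1 0 Q Pr)
    {φ : E³ → ℝ} (hφ : ContDiff ℝ 2 φ) (hφc : HasCompactSupport φ) {c : ℝ} (hc : c ≠ 0) :
    ∫ x, (c * fderiv ℝ φ (c • x) (Q x)) * (‖Q x‖ ^ 2 / 2 + Pr x) =
      (∫ x, φ (c • x) * frobeniusNormSq (fderiv ℝ Q x)) -
        2⁻¹ * ∫ x, (c ^ 2 * (Δ φ) (c • x)) * ‖Q x‖ ^ 2 := by
  -- regularity
  have hQ1 : ContDiff ℝ 1 Q := h.contDiff_velocity.of_le one_le_two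
  have hQc : Continuous Q := hQ1.continuous
  have hPc : Continuous Pr := h.contDiff_pressure.continuous
  have hφ1 : ContDiff ℝ 1 φ := hφ.of_le one_le_two
  have hDφc : Continuous (fderiv ℝ φ) := hφ1.continuous_fderiv one_ne_zero
  -- the rescaled test function
  have hψ2 : ContDiff ℝ 2 (fun x => φ (c • x)) := hφ.comp (contDiff_const_smul c)
  have hψc : HasCompactSupport (fun x => φ (c • x)) := hφc.comp_smul hc
  have hDψ : ∀ x, fderiv ℝ (fun x => φ (c • x)) x (Q x) = c * fderiv ℝ φ (c • x) (Q x) :=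
    fun x => by
    rw [fderiv_comp_smul c]
    rfl
  rw [h.integral_mul_frobeniusNormSq_eq hψ2 hψc]
  have eA : ∫ x, (Δ (fun x => φ (c • x))) x * ‖Q x‖ ^ 2 =
      ∫ x, (c ^ 2 * (Δ φ) (c • x)) * ‖Q x‖ ^ 2 :=
    integral_congr_ae (Eventually.of_forall fun x => by
      simp only [solitonFlux_laplacian_comp_smul φ c x])
  have eB : ∫ x, fderiv ℝ (fun x => φ (c • x)) x (Q x) * ‖Q x‖ ^ 2 =
      ∫ x, (c * fderiv ℝ φ (c • x) (Q x)) * ‖Q x‖ ^ 2 :=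
    integral_congr_ae (Eventually.of_forall fun x => by simp only [hDψ x])
  have eP : ∫ x, Pr x * fderiv ℝ (fun x => φ (c • x)) x (Q x) =
      ∫ x, Pr x * (c * fderiv ℝ φ (c • x) (Q x)) :=
    integral_congr_ae (Eventually.of_forall fun x => by simp only [hDψ x])
  rw [eA, eB, eP]
  -- integrability of the two flux integrands (continuous, compactly supported)
  have hgc : Continuous fun x => c * fderiv ℝ φ (c • x) (Q x) :=
    continuous_const.mul ((hDφc.comp (continuous_const_smul c)).clm_apply hQc)
  have hgcs : HasCompactSupport fun x => c * fderiv ℝ φ (c • x) (Q x) := by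
    refine ((hφc.fderiv (𝕜 := ℝ)).comp_smul hc).mono fun x hx => ?_
    simp only [Function.mem_support, ne_eq] at hx ⊢
    intro h0
    exact hx (by simp [h0])
  have hI1 : Integrable fun x => (c * fderiv ℝ φ (c • x) (Q x)) * ‖Q x‖ ^ 2 :=
    (hgc.mul (hQc.norm.pow 2)).integrable_of_hasCompactSupport hgcs.mul_right
  have hI2 : Integrable fun x => Pr x * (c * fderiv ℝ φ (c • x) (Q x)) :=
    (hPc.mul hgc).integrable_of_hasCompactSupport hgcs.mul_left
  have e : ∫ x, (c * fderiv ℝ φ (c • x) (Q x)) * (‖Q x‖ ^ 2 / 2 + Pr x) =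
      2⁻¹ * (∫ x, (c * fderiv ℝ φ (c • x) (Q x)) * ‖Q x‖ ^ 2) +
        ∫ x, Pr x * (c * fderiv ℝ φ (c • x) (Q x)) := by
    calc ∫ x, (c * fderiv ℝ φ (c • x) (Q x)) * (‖Q x‖ ^ 2 / 2 + Pr x)
        = ∫ x, (2⁻¹ * ((c * fderiv ℝ φ (c • x) (Q x)) * ‖Q x‖ ^ 2) +
            Pr x * (c * fderiv ℝ φ (c • x) (Q x))) :=
          integral_congr_ae (Eventually.of_forall fun x => by simp only; ring)
      _ = (∫ x, 2⁻¹ * ((c * fderiv ℝ φ (c • x) (Q x)) * ‖Q x‖ ^ 2)) +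
            ∫ x, Pr x * (c * fderiv ℝ φ (c • x) (Q x)) := integral_add (hI1.const_mul _) hI2
      _ = _ := by rw [integral_const_mul]
  rw [e]
  ring

/-- **The Laplacian term is negligible.** If `tsupport φ ⊆ B(0, ρ)` with `ρ ≥ 1`, `|Δφ| ≤ S`,
`∫_{B_R} |Q|² ≤ C R^{5/3}` for `R ≥ 1`, and `0 < c ≤ 1`, then
`|∫ c² (Δφ)(cx) |Q(x)|² dx| ≤ S C ρ^{5/3} c^{1/3}` (the integrand lives in `B(0, ρ/c)` and is
bounded by `c² S |Q|²` there). -/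
theorem solitonFlux_laplacian_term_le {Q : E³ → E³} (hQc : Continuous Q) {C : ℝ}
    (henv : ∀ R : ℝ, 1 ≤ R → ∫ x in Metric.ball (0 : E³) R, ‖Q x‖ ^ 2 ≤ C * R ^ (5 / 3 : ℝ))
    {φ : E³ → ℝ} (hφ : ContDiff ℝ 2 φ) {ρ S : ℝ} (hρ1 : 1 ≤ ρ)
    (hρ : tsupport φ ⊆ Metric.ball (0 : E³) ρ) (hS : ∀ x, ‖(Δ φ) x‖ ≤ S) {c : ℝ} (hc : 0 < c)
    (hc1 : c ≤ 1) :
    ‖∫ x, (c ^ 2 * (Δ φ) (c • x)) * ‖Q x‖ ^ 2‖ ≤ S * C * ρ ^ (5 / 3 : ℝ) * c ^ (1 / 3 : ℝ) := by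
  have hS0 : 0 ≤ S := le_trans (norm_nonneg _) (hS 0)
  have hρ0 : 0 ≤ ρ := zero_le_one.trans hρ1
  set R : ℝ := ρ * c⁻¹ with hR
  have hR1 : 1 ≤ R := one_le_mul_of_one_le_of_one_le hρ1 ((one_le_inv₀ hc).2 hc1)
  -- the integrand vanishes off `B(0, R)`
  have hzero : ∀ x, x ∉ Metric.ball (0 : E³) R → (c ^ 2 * (Δ φ) (c • x)) * ‖Q x‖ ^ 2 = 0 := by
    intro x hx
    have hx' : c • x ∉ tsupport φ := fun hmem => hx (by
      have h1 := hρ hmem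
      rw [mem_ball_zero_iff, norm_smul, Real.norm_of_nonneg hc.le] at h1
      rw [mem_ball_zero_iff, hR, ← div_eq_mul_inv, lt_div_iff₀ hc, mul_comm]
      exact h1)
    rw [laplacian_eq_zero_of_notMem_tsupport hx', mul_zero, zero_mul]
  -- and is bounded by `c² S |Q|²`
  have hbound : ∀ x, ‖(c ^ 2 * (Δ φ) (c • x)) * ‖Q x‖ ^ 2‖ ≤ c ^ 2 * S * ‖Q x‖ ^ 2 := by
    intro x
    rw [norm_mul, norm_mul, norm_pow, norm_pow, norm_norm, Real.norm_of_nonneg hc.le]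
    gcongr
    exact hS _
  -- integrability
  have hΔc : Continuous fun x => (c ^ 2 * (Δ φ) (c • x)) * ‖Q x‖ ^ 2 :=
    (continuous_const.mul ((continuous_laplacian hφ).comp (continuous_const_smul c))).mul
      (hQc.norm.pow 2)
  have hΔcs : HasCompactSupport fun x => (c ^ 2 * (Δ φ) (c • x)) * ‖Q x‖ ^ 2 := by
    refine HasCompactSupport.of_support_subset_isCompact (isCompact_closedBall (0 : E³) R) ?_
    intro x hx
    rw [Function.mem_support] at hx
    by_contra hx'
    exact hx (hzero x fun hb => hx' (Metric.ball_subset_closedBall hb))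
  have hI1 : IntegrableOn (fun x => ‖(c ^ 2 * (Δ φ) (c • x)) * ‖Q x‖ ^ 2‖) (Metric.ball (0 : E³) R) :=
    (hΔc.integrable_of_hasCompactSupport hΔcs).norm.integrableOn
  have hQball : IntegrableOn (fun x => ‖Q x‖ ^ 2) (Metric.ball (0 : E³) R) :=
    ((hQc.norm.pow 2).continuousOn.integrableOn_compact (isCompact_closedBall (0 : E³) R)).mono_set
      Metric.ball_subset_closedBall
  have hI2 : IntegrableOn (fun x => c ^ 2 * S * ‖Q x‖ ^ 2) (Metric.ball (0 : E³) R) :=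
    hQball.const_mul _
  calc ‖∫ x, (c ^ 2 * (Δ φ) (c • x)) * ‖Q x‖ ^ 2‖
      ≤ ∫ x, ‖(c ^ 2 * (Δ φ) (c • x)) * ‖Q x‖ ^ 2‖ := norm_integral_le_integral_norm _
    _ = ∫ x in Metric.ball (0 : E³) R, ‖(c ^ 2 * (Δ φ) (c • x)) * ‖Q x‖ ^ 2‖ :=
        (setIntegral_eq_integral_of_forall_compl_eq_zero fun x hx => by
          rw [hzero x hx, norm_zero]).symm
    _ ≤ ∫ x in Metric.ball (0 : E³) R, c ^ 2 * S * ‖Q x‖ ^ 2 :=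
        setIntegral_mono hI1 hI2 fun x => hbound x
    _ = c ^ 2 * S * ∫ x in Metric.ball (0 : E³) R, ‖Q x‖ ^ 2 := integral_const_mul _ _
    _ ≤ c ^ 2 * S * (C * R ^ (5 / 3 : ℝ)) :=
        mul_le_mul_of_nonneg_left (henv R hR1) (by positivity)
    _ = S * C * ρ ^ (5 / 3 : ℝ) * (c ^ 2 * c⁻¹ ^ (5 / 3 : ℝ)) := by
        rw [hR, Real.mul_rpow hρ0 (inv_nonneg.2 hc.le)]
        ring
    _ = S * C * ρ ^ (5 / 3 : ℝ) * c ^ (1 / 3 : ℝ) := by rw [solitonFlux_rpow_aux hc]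

/-- **The dissipation term.** If `|∇Q|²` is integrable, `φ` is continuous and bounded, and
`c_k → 0`, then `∫ φ(c_k x) |∇Q|²(x) dx → φ(0) ∫ |∇Q|²` (dominated convergence). -/
theorem solitonFlux_tendsto_dissipation {Q : E³ → E³} (hQ1 : ContDiff ℝ 1 Q)
    (hD : Integrable (fun x => frobeniusNormSq (fderiv ℝ Q x))) {φ : E³ → ℝ}
    (hφ : Continuous φ) {M : ℝ} (hM : ∀ x, ‖φ x‖ ≤ M) {c : ℕ → ℝ}
    (hc0 : Tendsto c atTop (𝓝 0)) :
    Tendsto (fun k => ∫ x, φ (c k • x) * frobeniusNormSq (fderiv ℝ Q x)) atTop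
      (𝓝 (φ 0 * ∫ x, frobeniusNormSq (fderiv ℝ Q x))) := by
  have hDQc : Continuous (fderiv ℝ Q) := hQ1.continuous_fderiv one_ne_zero
  have hFc : Continuous fun x => frobeniusNormSq (fderiv ℝ Q x) := by
    unfold frobeniusNormSq
    fun_prop
  rw [← integral_const_mul]
  refine tendsto_integral_of_dominated_convergence (fun x => M * frobeniusNormSq (fderiv ℝ Q x))
    (fun k => ((hφ.comp (continuous_const_smul (c k))).mul hFc).aestronglyMeasurable)
    (hD.const_mul M) (fun k => Eventually.of_forall fun x => ?_) (Eventually.of_forall fun x => ?_)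
  · rw [norm_mul, Real.norm_of_nonneg (frobeniusNormSq_nonneg _)]
    exact mul_le_mul_of_nonneg_right (hM _) (frobeniusNormSq_nonneg _)
  · have h1 : Tendsto (fun k => c k • x) atTop (𝓝 0) := by simpa using hc0.smul_const x
    exact ((hφ.tendsto 0).comp h1).mul_const _

/-- **The soliton energy–flux identity along a positive null sequence of scales.** For a smooth
steady unforced unit-viscosity Navier–Stokes solution `(Q, Pr)` on `ℝ³` with finite Dirichlet
integral and the `L²`-mass envelope `∫_{B_R}|Q|² ≤ C R^{5/3}` (`R ≥ 1`), a test function `φ ∈ C²_c`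
and scales `0 < c_k ≤ 1`, `c_k → 0`:
`∫ (c_k Dφ(c_k x)·Q(x)) (|Q|²/2 + Pr) dx → φ(0) ∫ |∇Q|²`. -/
theorem solitonFlux_tendsto {Q : E³ → E³} {Pr : E³ → ℝ} (h : IsSteadyClassicalNS 1 0 Q Pr)
    (hD : Integrable (fun x => frobeniusNormSq (fderiv ℝ Q x))) {C : ℝ}
    (henv : ∀ R : ℝ, 1 ≤ R → ∫ x in Metric.ball (0 : E³) R, ‖Q x‖ ^ 2 ≤ C * R ^ (5 / 3 : ℝ))
    {φ : E³ → ℝ} (hφ : ContDiff ℝ 2 φ) (hφc : HasCompactSupport φ) {c : ℕ → ℝ}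
    (hcpos : ∀ k, 0 < c k) (hc1 : ∀ k, c k ≤ 1) (hc0 : Tendsto c atTop (𝓝 0)) :
    Tendsto (fun k => ∫ x, (c k * fderiv ℝ φ (c k • x) (Q x)) * (‖Q x‖ ^ 2 / 2 + Pr x)) atTop
      (𝓝 (φ 0 * ∫ x, frobeniusNormSq (fderiv ℝ Q x))) := by
  have hprof : IsLerayProfile 1 0 Q Pr := solitonFlux_isLerayProfile h
  have hQ1 : ContDiff ℝ 1 Q := contDiff_infty.1 h.smooth_velocity 1
  have hQc : Continuous Q := hQ1.continuous
  have hφcn : Continuous φ := hφ.continuous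
  -- bounds for `φ` and `Δφ`, support radius
  obtain ⟨M, hM⟩ : ∃ M, ∀ x, ‖φ x‖ ≤ M := hφcn.bounded_above_of_compact_support hφc
  have hΔφcs : HasCompactSupport (Δ φ) := hφc.mono' fun x hx => by
    contrapose! hx
    simp [laplacian_eq_zero_of_notMem_tsupport hx]
  obtain ⟨S, hS⟩ : ∃ S, ∀ x, ‖(Δ φ) x‖ ≤ S :=
    (continuous_laplacian hφ).bounded_above_of_compact_support hΔφcs
  obtain ⟨ρ, hρ1, hρ⟩ : ∃ ρ : ℝ, 1 ≤ ρ ∧ tsupport φ ⊆ Metric.ball (0 : E³) ρ := by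
    obtain ⟨r, hr⟩ := hφc.isCompact.isBounded.subset_ball (0 : E³)
    exact ⟨max r 1, le_max_right _ _, hr.trans (Metric.ball_subset_ball (le_max_left _ _))⟩
  -- the two limits
  have hT1 := solitonFlux_tendsto_dissipation hQ1 hD hφcn hM hc0
  have hT2 : Tendsto (fun k => ∫ x, (c k ^ 2 * (Δ φ) (c k • x)) * ‖Q x‖ ^ 2) atTop (𝓝 0) := by
    refine squeeze_zero_norm (fun k => solitonFlux_laplacian_term_le hQc henv hφ hρ1 hρ hS
      (hcpos k) (hc1 k)) ?_
    have h13 : Tendsto (fun k => (c k) ^ (1 / 3 : ℝ)) atTop (𝓝 0) := by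
      have := hc0.rpow_const (p := (1 / 3 : ℝ)) (Or.inr (by norm_num))
      simpa [Real.zero_rpow (by norm_num : (1 / 3 : ℝ) ≠ 0)] using this
    simpa using h13.const_mul (S * C * ρ ^ (5 / 3 : ℝ))
  have hT := hT1.sub (hT2.const_mul 2⁻¹)
  rw [mul_zero, sub_zero] at hT
  exact hT.congr fun k => (solitonFlux_identity hprof hφ hφc (hcpos k).ne').symm

/-- **Stub `stub_solitonEnergyFlux` (the soliton energy–flux identity).** For a smooth steady
unforced unit-viscosity Navier–Stokes solution `(Q, Pr)` on `ℝ³` with finite Dirichlet integral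
`D = ∫ |∇Q|²` and `∫_{B_R}|Q|² ≤ C R^{5/3}` (`R ≥ 1`), `λ > 1`, and `φ ∈ C²_c(ℝ³)`: with
`φ_k(x) = φ((λ^k)⁻¹ x)`, `∫ (Dφ_k·Q)(½|Q|² + Pr) → φ(0) D` — the dissipation is fed from infinity
through the tested energy flux (Galdi 2011, proof of Thm X.9.5; Seregin–Wang 2020, proof of
Prop. 2.1). -/
theorem stub_solitonEnergyFlux :
    ∀ (Q : EuclideanSpace ℝ (Fin 3) → EuclideanSpace ℝ (Fin 3)) (Pr : EuclideanSpace ℝ (Fin 3) → ℝ) (φ : EuclideanSpace ℝ (Fin 3) → ℝ) (lam C : ℝ), Literature.Analysis.FluidPDE.IsSteadyClassicalNS 1 0 Q Pr → MeasureTheory.Integrable (fun x => Literature.Analysis.FluidPDE.frobeniusNormSq (fderiv ℝ Q x)) → (∀ R : ℝ, 1 ≤ R → ∫ x in Metric.ball (0 : EuclideanSpace ℝ (Fin 3)) R, ‖Q x‖ ^ 2 ≤ C * R ^ (5 / 3 : ℝ)) → 1 < lam → ContDiff ℝ 2 φ → HasCompactSupport φ → Filter.Tendsto (fun k : ℕ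 => ∫ x, ((lam ^ k)⁻¹ * fderiv ℝ φ ((lam ^ k)⁻¹ • x) (Q x)) * (‖Q x‖ ^ 2 / 2 + Pr x)) Filter.atTop (nhds (φ 0 * ∫ x, Literature.Analysis.FluidPDE.frobeniusNormSq (fderiv ℝ Q x))) := by
  intro Q Pr φ lam C h hD henv hlam hφ hφc
  have hlam0 : 0 < lam := one_pos.trans hlam
  refine solitonFlux_tendsto h hD henv hφ hφc (c := fun k => (lam ^ k)⁻¹)
    (fun k => inv_pos.2 (pow_pos hlam0 k)) (fun k => inv_le_one_of_one_le₀ (one_le_pow₀ hlam.le))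
    ?_
  exact tendsto_inv_atTop_zero.comp (tendsto_pow_atTop_atTop_of_one_lt hlam)

end Summit.AnomalousDissipation.AnomalousDissipation.Theorems

end
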